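import Summits.BirchSwinnertonDyer.BirchSwinnertonDyer.Theorems.SylvesterTwoHeegnerIndexThmCDefs
import Summits.BirchSwinnertonDyer.BirchSwinnertonDyer.Theorems.SylvesterTwoHeegnerIndexTwoAdicPairParity
import Summits.BirchSwinnertonDyer.BirchSwinnertonDyer.Theses.SylvesterTwoHeegnerIndex
import HarnessLib

/-!
# Route `SylvesterTwoHeegnerIndex` (rung K7t), item 19580 `TwoAdicPairHSY`: THE ASSEMBLY
# `[Hu–Shu–Yin's display (PRINT)] → [THEOREM C (cell theorem, fact-free def)] → TwoAdicPairHSY`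

Cell `b2b-bsdres`, seat x1b GEN 49 (prover-b2b-bsdres-x1b-g49-0), O12/O10 class lead, under the
planner's D115 re-opening (bsd-cm STATUS 2026-08-26T16:09:26Z: «the assembly is RE-OPENED TO THE FIRST
LIVE CLAIMANT»; CLAIM ThmCAssembly posted on STATUS before filing). `--supports
stmt-BirchSwinnertonDyer-19580`. PARTITION (D55): CornerF at `p = 2` (B14/O12) × 𝒞_HSY (every
`p ≡ 4, 7 (mod 9)`) × `p = 2` — types-the-object-of; this file CLOSES NO ITEM by itself (19580 is
FACT-FREE and stays open; the planner's cascade E1–E4 files the facts-plus twin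
`TwoAdicPairHSYOfFactsPlusOfThmC`, which this assembly closes verbatim); BSD is not claimed.
NO definition, NO named fact declared here, NO `sorry`.

THE THREE LAYERS (planner D104/D107):
* PRINT — x1b GEN 48's cited fact `HuShuYin2019.shaAnPair_mul_height_eq_two_zpow_mul_height`
  (Hu–Shu–Yin 2019 p. 12 display (bsd) with Cor 4.4, p. 8, Thm 1.3): over any quadratic `K ∋ ω`,
  `#Ш_an(B)·#Ш_an(A) = qB·qA ∈ ℚ^×`, `rank_ℤ B(K) = 2`, and `(qB·qA)·ĥ_K(ι P) = 2^i·ĥ_K(Y)` for a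
  generator `P` and some `Y ∈ B(K)`, `i = 0 | −2` as `p ≡ 4 | 7 (mod 9)`.
* PARITY (x1b GEN 48, kernel) — `SylvesterTwoCMNormForm.twoAdicPairHSY_parity`: `ord₂(qB·qA) = 2n`,
  `n ∈ ℤ`, for EVERY member (`2` inert in `ℤ[ω]`, Néron–Tate norm form).
* NON-NEGATIVITY (bsd-cm-two g5, kernel) — `SylvesterTwoNonneg.exists_nat_padicValRat_two_eq_of_model`
  (`p ≡ 4 (9)`: the generator is not halvable ⇒ `n ≥ 0`) and
  `SylvesterTwoNonneg.exists_nat_padicValRat_two_eq_of_model_of_thmC` (`p ≡ 7 (9)`: modulo the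
  fact-free def `SylvesterTwoNonneg.HSYPointTwoDivisibleSevenModNine` = MEMO THEOREM C, «Hu–Shu–Yin's `Y`
  lies in `2·E_p(K) + tors`», refereed in the cell, NOT in print, NOT kernel — its one explicit
  computation is kernel: `SylvesterTwoThmCCert.thmC_shimura_certificate`, x1b GEN 49).

CONTENTS (all at `K = ℚ(ζ₃) = CyclotomicField 3 ℚ`, `ω = ζ₃`, via x1b's engine lemmas
`sq_add_self_add_one_eq_zero_of_isPrimitiveRoot`, `finrank_cyclotomicField_three`;
`exists_omega_cyclotomicField_three` packages `ω`):
* `twoAdicPairHSY_of_heightDisplay_mod_nine_eq_four` — the `p ≡ 4 (mod 9)` half of 19580 with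
  `n : ℕ`, from the display ALONE;
* **`twoAdicPairHSY_of_heightDisplay_of_thmC : shaAnPair_mul_height_eq_two_zpow_mul_height →
  HSYPointTwoDivisibleSevenModNine → TwoAdicPairHSY`** — THE ASSEMBLY (the conclusion is the route
  decl `Summit.BirchSwinnertonDyer.BirchSwinnertonDyer.Theses.SylvesterTwoHeegnerIndex.TwoAdicPairHSY`
  by name);
* `pairProductTwoIntegral_of_heightDisplay_of_thmC` — display + Theorem C ⇒
  `SylvesterTwoNonneg.PairProductTwoIntegralSevenModNine` (`0 ≤ ord₂` on `p ≡ 7 (9)`);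
* `twoAdicPairHSY_of_heightDisplay_of_twoIntegral` — display + `PairProductTwoIntegralSevenModNine` ⇒
  `TwoAdicPairHSY` (the `2`-integrality reading: parity + `≥ 0`).
So, modulo the ONE printed display: `TwoAdicPairHSY ⟸ THEOREM C ⟸⟹`-direction-wise,
`THEOREM C ⟹ PairProductTwoIntegralSevenModNine ⟹ TwoAdicPairHSY`, and on `p ≡ 4 (9)` nothing is needed.

WHAT THIS IS NOT: not a proof of 19580 (fact-free item; stays open); not Theorem C; not BSD(E_p, 2);
nothing booked, no label / mark / count / tier moves.

## References
* Y. Hu, J. Shu, H. Yin, Trans. AMS 372 (2019) = arXiv:1708.05266: Thm 1.3, p. 8, Cor 4.4, p. 12 (bsd).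
* MEMO bsd-cm-two v2.6/v2.7 §15.5 (THEOREM C), §37–§38; planner memos CLOSURE-PATH-19580 (g17) §2/§6,
  bsd-cm STATUS D104/D107/D108/D115.
-/

set_option autoImplicit false
-- the Summit-side namespace `Summit.BirchSwinnertonDyer.BirchSwinnertonDyer.…` (summit = problem) is mandated by D-0017
set_option linter.dupNamespace false

noncomputable section

open scoped Classical

open WeierstrassCurve WeierstrassCurve.Affine WeierstrassCurve.Affine.Point
  Literature.NumberTheory.EllipticCurves Literature.NumberTheory.EllipticCurves.HuShuYin2019
  Summit.BirchSwinnertonDyer.BirchSwinnertonDyer.Theorems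
  Summit.BirchSwinnertonDyer.BirchSwinnertonDyer.Theorems.SylvesterTwoCMNormForm
  Summit.BirchSwinnertonDyer.BirchSwinnertonDyer.Theorems.SylvesterTwoNonneg

-- buildfix (bf3-g25, 2026-08-26): the route file's gen-10 split (22:20Z) declares its own
-- `Theses.SylvesterTwoHeegnerIndex.HSYPointTwoDivisibleSevenModNine` (THEOREM C inlined verbatim);
-- this assembly means bsd-cm-two's `SylvesterTwoNonneg.HSYPointTwoDivisibleSevenModNine` throughout
-- (as at accept time, p456911), so the route namespace is opened hiding the homonym.
open Summit.BirchSwinnertonDyer.BirchSwinnertonDyer.Theses.SylvesterTwoHeegnerIndex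
  hiding HSYPointTwoDivisibleSevenModNine

namespace Summit.BirchSwinnertonDyer.BirchSwinnertonDyer.Theorems.SylvesterTwoThmCAssembly

/-- `K = ℚ(ζ₃) = CyclotomicField 3 ℚ` contains an `ω` with `ω² + ω + 1 = 0` (namely `ζ₃`; x1b's
engine lemma `sq_add_self_add_one_eq_zero_of_isPrimitiveRoot`, the cyclotomic instance supplied by
hand as in `…TwoAdicPairParity`). [cite: HuShuYin2019, p. 4 (K = ℚ(√−3), ω)] -/
theorem exists_omega_cyclotomicField_three : ∃ ω : CyclotomicField 3 ℚ, ω ^ 2 + ω + 1 = 0 := by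
  haveI : IsCyclotomicExtension {3} ℚ (CyclotomicField 3 ℚ) :=
    CyclotomicField.isCyclotomicExtension 3 ℚ
  exact ⟨_, sq_add_self_add_one_eq_zero_of_isPrimitiveRoot
    (IsCyclotomicExtension.zeta_spec 3 ℚ (CyclotomicField 3 ℚ))⟩

/-! ## §1 The `p ≡ 4 (mod 9)` half of item 19580, from the display alone -/

/-- **`TwoAdicPairHSY` on `p ≡ 4 (mod 9)`, modulo Hu–Shu–Yin's display ONLY.** For every prime
`p ≡ 4 (mod 9)` with `3 ∉ 𝔽_p^{×3}` and all globally minimal `B ≅ E_p`, `A ≅ E_{3p²}`: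
`#Ш_an(B) = qB`, `#Ш_an(A) = qA` rational, `qB·qA ≠ 0`, `ord₂(qB·qA) = 2n` with `n : ℕ` — verbatim
the body of `TwoAdicPairHSY` on this sub-family. Proof: the display at `K = ℚ(ζ₃)` (`i = 0`) and
bsd-cm-two's `exists_nat_padicValRat_two_eq_of_model` (x1b's parity + two's non-halvability).
[cite: HuShuYin2019, display (bsd) p. 12, p. 8] -/
theorem twoAdicPairHSY_of_heightDisplay_mod_nine_eq_four
    (hH : shaAnPair_mul_height_eq_two_zpow_mul_height) :
    ∀ (p : ℕ), p.Prime → p % 9 = 4 → (¬ ∃ x : ZMod p, x ^ 3 = 3) →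
      ∀ (A B : WeierstrassCurve ℚ) [A.IsElliptic] [A.IsGloballyMinimal]
        [B.IsElliptic] [B.IsGloballyMinimal],
        (∃ C : VariableChange ℚ, C • B = cubeSumCurve (p : ℚ)) →
        (∃ C : VariableChange ℚ, C • A = cubeSumCurve (3 * (p : ℚ) ^ 2)) →
        ∃ qB qA : ℚ, shaAn B = (qB : ℂ) ∧ shaAn A = (qA : ℂ) ∧ qB * qA ≠ 0 ∧
          ∃ n : ℕ, padicValRat 2 (qB * qA) = 2 * n := by
  intro p hp h4 h3 A B _ _ _ _ hB hA
  obtain ⟨ω, hω⟩ := exists_omega_cyclotomicField_three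
  obtain ⟨qB, qA, hqB, hqA, hne, hrank, P, Y, hP, hgen, hid⟩ :=
    hH p hp (Or.inl h4) h3 A B hB hA (CyclotomicField 3 ℚ) ω hω finrank_cyclotomicField_three
  obtain ⟨C, hC⟩ := hB
  have hp2 : p ≠ 2 := by rintro rfl; norm_num at h4
  rw [if_pos h4, zpow_zero, one_mul] at hid
  obtain ⟨m, hm⟩ := exists_nat_padicValRat_two_eq_of_model hω finrank_cyclotomicField_three hp hp2 B
    C hC hrank P hP hgen Y hne hid
  exact ⟨qB, qA, hqB, hqA, hne, m, hm⟩

/-! ## §2 THE ASSEMBLY: display → THEOREM C → `TwoAdicPairHSY` -/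

/-- **THE ASSEMBLY of crux 19580 (planner D104/D107; D115 claimant x1b GEN 49).** Hu–Shu–Yin's printed
display (x1b's cited fact) and MEMO THEOREM C (bsd-cm-two's fact-free def
`HSYPointTwoDivisibleSevenModNine`: Hu–Shu–Yin's `Y` lies in `2·E_p(K) + E_p(K)_tors` for every
`p ≡ 7 (mod 9)`) imply the route decl `TwoAdicPairHSY` VERBATIM: for every prime `p ≡ 4, 7 (mod 9)`
with `3 ∉ 𝔽_p^{×3}` and all minimal `B ≅ E_p`, `A ≅ E_{3p²}`, `ord₂(#Ш_an(B)·#Ш_an(A)) = 2n`, `n : ℕ`.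
`p ≡ 4 (9)`: §1 (Theorem C not used); `p ≡ 7 (9)`: the display at `K = ℚ(ζ₃)` (`i = −2`) fed to
bsd-cm-two's `exists_nat_padicValRat_two_eq_of_model_of_thmC`. This is the closer of the cascade's
facts-plus child `TwoAdicPairHSYOfFactsPlusOfThmC` (CLOSURE-PATH-19580 §6 E2).
[cite: HuShuYin2019, display (bsd) p. 12, p. 8, Thm 1.3] -/
theorem twoAdicPairHSY_of_heightDisplay_of_thmC (hH : shaAnPair_mul_height_eq_two_zpow_mul_height)
    (hC : HSYPointTwoDivisibleSevenModNine) : TwoAdicPairHSY := by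
  intro p hp h9 h3 A B _ _ _ _ hB hA
  rcases h9 with h4 | h7
  · exact twoAdicPairHSY_of_heightDisplay_mod_nine_eq_four hH p hp h4 h3 A B hB hA
  · obtain ⟨ω, hω⟩ := exists_omega_cyclotomicField_three
    obtain ⟨qB, qA, hqB, hqA, hne, hrank, P, Y, hP, hgen, hid⟩ :=
      hH p hp (Or.inr h7) h3 A B hB hA (CyclotomicField 3 ℚ) ω hω finrank_cyclotomicField_three
    have h4 : ¬ p % 9 = 4 := by omega
    rw [if_neg h4] at hid
    obtain ⟨C, hCB⟩ := hB
    obtain ⟨m, hm⟩ := exists_nat_padicValRat_two_eq_of_model_of_thmC hC hω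
      finrank_cyclotomicField_three hp h7 h3 A B C hCB hA hrank P hP hgen Y hqB hqA hne hid
    exact ⟨qB, qA, hqB, hqA, hne, m, hm⟩

/-! ## §3 The `2`-integrality reading (`PairProductTwoIntegralSevenModNine`) both ways -/

/-- **Display + THEOREM C ⇒ the pair product is a `2`-adic integer on `p ≡ 7 (mod 9)`**
(`SylvesterTwoNonneg.PairProductTwoIntegralSevenModNine`): `0 ≤ ord₂(#Ш_an(B)·#Ш_an(A))`. The
rationals `qB, qA` of the conclusion are ANY with `shaAn B = qB`, `shaAn A = qA`; they agree with the
display's by injectivity of `ℚ → ℂ`. [cite: HuShuYin2019, display (bsd) p. 12] -/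
theorem pairProductTwoIntegral_of_heightDisplay_of_thmC
    (hH : shaAnPair_mul_height_eq_two_zpow_mul_height) (hC : HSYPointTwoDivisibleSevenModNine) :
    PairProductTwoIntegralSevenModNine := by
  intro p hp h7 h3 A B _ _ _ _ hB hA qB qA hqB hqA
  obtain ⟨qB', qA', hqB', hqA', hne, n, hn⟩ :=
    twoAdicPairHSY_of_heightDisplay_of_thmC hH hC p hp (Or.inr h7) h3 A B hB hA
  have eB : qB = qB' := by exact_mod_cast hqB.symm.trans hqB'
  have eA : qA = qA' := by exact_mod_cast hqA.symm.trans hqA'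
  rw [eB, eA, hn]
  positivity

/-- **Display + `2`-integrality on `p ≡ 7 (mod 9)` ⇒ `TwoAdicPairHSY`** (the converse reading: what
Theorem C is USED for is exactly `0 ≤ ord₂(#Ш_an(B)·#Ш_an(A))` on `p ≡ 7 (9)`): x1b's parity
`twoAdicPairHSY_parity` gives `ord₂ = 2n`, `n ∈ ℤ`, for every member; `≥ 0` makes `n : ℕ`; the
`p ≡ 4 (9)` half is §1. [cite: HuShuYin2019, display (bsd) p. 12] -/
theorem twoAdicPairHSY_of_heightDisplay_of_twoIntegral
    (hH : shaAnPair_mul_height_eq_two_zpow_mul_height) (hI : PairProductTwoIntegralSevenModNine) :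
    TwoAdicPairHSY := by
  intro p hp h9 h3 A B _ _ _ _ hB hA
  rcases h9 with h4 | h7
  · exact twoAdicPairHSY_of_heightDisplay_mod_nine_eq_four hH p hp h4 h3 A B hB hA
  · obtain ⟨qB, qA, hqB, hqA, hne, n, hn⟩ := twoAdicPairHSY_parity hH p hp (Or.inr h7) h3 A B hB hA
    have h0 : 0 ≤ padicValRat 2 (qB * qA) := hI p hp h7 h3 A B hB hA qB qA hqB hqA
    refine ⟨qB, qA, hqB, hqA, hne, n.toNat, ?_⟩
    have hn0 : 0 ≤ n := by rw [hn] at h0; omega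
    rw [hn, Int.toNat_of_nonneg hn0]

end Summit.BirchSwinnertonDyer.BirchSwinnertonDyer.Theorems.SylvesterTwoThmCAssembly

end
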